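import Summits.Ventures.CertifiedManyBodySolver.Observables.RungLeavesCoverageNdNiO2Cut
import Summits.Ventures.CertifiedManyBodySolver.Theses.CovNdNiO2M21
import HarnessLib

/-!
# BC3 birth skeleton — route CovNdNiO2M21, crux `ResidualLowUSlab` («hubbard-cov-ndnio2-1») — DRAFT FOR THE PEN by seat hubbard-cov-ndnio2-box-2.
Two registered stubs (the f-sum apex STATION at `U_A = 5` read with the two END objectives, one unconditional orbit-lower family per
objective, density-parametrised over the SOLVE-OWING interval x ∈ [183/200, 477/500] = R‴; the strip [9/10, 183/200] is discharged INSIDE the composition by box-2's node-free `ndnio2_M21_lowFillingCell183_below_bar`) and the kernel-checked composition `ResidualLowUSlab_of : ResidualLowUSlab` (from `stub_lowP`, `stub_lowQ` BY NAME) through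
`ObsStiffnessSeqCeilingAt_on_box_of_apexStation_twoEndObjectives` (p601528, unc-2 g15). Sorries ONLY inside `stub_*`.
POST-BIRTH form (route-Ventures-CovNdNiO2M21 OPENED 2026-08-28T07:46:11Z): the crux `ResidualLowUSlab` is the route module's own decl (imported; this file lives in its namespace).
The crux lives on the RESIDUAL CORNER CELL `t′ ∈ [−23/50, −11/25] × n ∈ [9/10, 477/500]` (the rest of the box is node-free kinematics below the bar, p608290).
HONEST FRAMING: stiffness CEILING transport on a downfolded box = CONTROL / CALIBRATION + labelled heuristic; not a phase sentence.
-/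

noncomputable section

namespace Summit.Ventures.CertifiedManyBodySolver.Theses.CovNdNiO2M21

open Set NonemptyInterval Filter Topology
open Summit.Ventures.CertifiedManyBodySolver.Observables
open Summit.Ventures.CertifiedManyBodySolver.Downfold
open Summit.Ventures.CertifiedManyBodySolver.Certificates
open Literature.MathematicalPhysics.QuantumLattice Literature.MathematicalPhysics.QuantumLattice.ThermodynamicLimit
open Literature.Probability.LatticeModels
open Matrix HubbardWave0
open scoped BigOperators ComplexOrder

/-- stub P (corner objective `−X₀(−23/50, 5)`): an unconditional orbit-lower family on the station segment at every density of the box,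
with values certifying `≤ 0.4779578`. PRODUCER: f-sum station window certificates at `U = 5`, sources `s ∈ [−0.566, −0.44]` (station factor 2 − 5/(13/2) = 16/13, far source (−23/50)(16/13) = −184/325 ≈ −0.566), read
density-affinely / by interval caps on x ∈ [183/200, 477/500] (edges `0.915`, `0.954`) (unc-2: no filling transport price). -/
theorem stub_lowP :
    ∃ vP : ℝ → ℝ → ℝ,
    (∀ x ∈ Set.Icc (183 / 200 : ℝ) (477 / 500), ∀ s ∈ Set.Icc ((-23 / 50 : ℝ) * (2 - (5 : ℝ) / (13 / 2 : ℝ))) (-11 / 25),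
      ∀ (ω : InfVolFermionState 2) (Ls : ℕ → ℕ) (ψ : ∀ L, Fock (Orb (FermionTorus 2 L))),
      Tendsto Ls atTop atTop →
      (∀ j, IsGroundStateInSector (hubbardTorusTT' (Ls j) 1 s (5 : ℝ)) (rectN x (Ls j)) 0 (ψ (Ls j))) →
      (∀ j, star (ψ (Ls j)) ⬝ᵥ ψ (Ls j) = 1) → ω.IsTorusLimitOf ψ Ls →
      vP x s ≤ ((Finset.univ : Finset (DihedralGroup 4)).card : ℝ)⁻¹ * ∑ g ∈ (Finset.univ : Finset (DihedralGroup 4)),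
        (ω.expect (d4ShiftSet g 0 (Literature.Probability.LatticeModels.box 2 7))
          (fermionEmbed (PolySite.d4Emb g 0 (Literature.Probability.LatticeModels.box 2 7)) (-oddMomentObsTT (-23 / 50 : ℝ) (5 : ℝ) 0))).re)
    ∧ (∀ x ∈ Set.Icc (183 / 200 : ℝ) (477 / 500), ∀ s ∈ Set.Icc ((-23 / 50 : ℝ) * (2 - (5 : ℝ) / (13 / 2 : ℝ))) (-11 / 25),
      -vP x s ≤ (4779578 / 10000000 : ℝ)) := by
  sorry

/-- stub Q (inner objective `−X₀(−11/25, 5)` (the cut slot)): the same station read with the inner END objective. -/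
theorem stub_lowQ :
    ∃ vQ : ℝ → ℝ → ℝ,
    (∀ x ∈ Set.Icc (183 / 200 : ℝ) (477 / 500), ∀ s ∈ Set.Icc ((-23 / 50 : ℝ) * (2 - (5 : ℝ) / (13 / 2 : ℝ))) (-11 / 25),
      ∀ (ω : InfVolFermionState 2) (Ls : ℕ → ℕ) (ψ : ∀ L, Fock (Orb (FermionTorus 2 L))),
      Tendsto Ls atTop atTop →
      (∀ j, IsGroundStateInSector (hubbardTorusTT' (Ls j) 1 s (5 : ℝ)) (rectN x (Ls j)) 0 (ψ (Ls j))) →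
      (∀ j, star (ψ (Ls j)) ⬝ᵥ ψ (Ls j) = 1) → ω.IsTorusLimitOf ψ Ls →
      vQ x s ≤ ((Finset.univ : Finset (DihedralGroup 4)).card : ℝ)⁻¹ * ∑ g ∈ (Finset.univ : Finset (DihedralGroup 4)),
        (ω.expect (d4ShiftSet g 0 (Literature.Probability.LatticeModels.box 2 7))
          (fermionEmbed (PolySite.d4Emb g 0 (Literature.Probability.LatticeModels.box 2 7)) (-oddMomentObsTT (-11 / 25 : ℝ) (5 : ℝ) 0))).re)
    ∧ (∀ x ∈ Set.Icc (183 / 200 : ℝ) (477 / 500), ∀ s ∈ Set.Icc ((-23 / 50 : ℝ) * (2 - (5 : ℝ) / (13 / 2 : ℝ))) (-11 / 25),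
      -vQ x s ≤ (4779578 / 10000000 : ℝ)) := by
  sorry

/-- The composition `ResidualLowUSlab_of : ResidualLowUSlab` FROM THE TWO STUBS BY NAME (σ-chord of the two end objectives is a convex combination). -/
theorem ResidualLowUSlab_of : ResidualLowUSlab := by
  obtain ⟨vP, hPf, hPb⟩ := stub_lowP
  obtain ⟨vQ, hQf, hQb⟩ := stub_lowQ
  intro tp htp U hU n hn
  -- density split at 183/200: the strip n ∈ [9/10, 183/200] is node-free kinematics below the bar (box-2 p613797/p614807, `stub_kinN` of CAPTAIN WORD l.2391)
  rcases le_total n (183 / 200) with hlow | hhigh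
  · exact ndnio2_M21_lowFillingCell183_below_bar (U := U) htp ⟨by linarith [hn.1], hlow⟩
  have hn' : n ∈ Set.Icc (183 / 200 : ℝ) (477 / 500) := ⟨hhigh, hn.2⟩
  have hcast : (((4779578 / 10000000 : ℚ) : ℚ) : ℝ) = (4779578 / 10000000 : ℝ) := by push_cast; norm_num
  refine ObsStiffnessSeqCeilingAt_on_box_of_apexStation_twoEndObjectives (p := -23 / 50) (q := -11 / 25) (UA := (5 : ℝ))
    (Umax := (13 / 2 : ℝ)) (n := n) (by norm_num) (by norm_num) (by norm_num) (by linarith [hn'.1]) (by linarith [hn'.2]) (vP n) (vQ n)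
    (4779578 / 10000000) (hPf n hn') (hQf n hn') ?_ tp htp U hU
  intro σ hσ s hs
  have hf : (0 : ℝ) ≤ 2 - (5 : ℝ) / (13 / 2 : ℝ) := by norm_num
  have hsP : s ∈ Set.Icc ((-23 / 50 : ℝ) * (2 - (5 : ℝ) / (13 / 2 : ℝ))) (-11 / 25) :=
    ⟨(mul_le_mul_of_nonneg_right hσ.1 hf).trans hs.1, hs.2.trans hσ.2⟩
  have hA := hPb n hn' s hsP
  have hB := hQb n hn' s hsP
  have ha : (0 : ℝ) ≤ (-11 / 25 - σ) / (-11 / 25 - -23 / 50) := div_nonneg (by linarith [hσ.2]) (by norm_num)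
  have hb : (0 : ℝ) ≤ (σ - -23 / 50) / (-11 / 25 - -23 / 50) := div_nonneg (by linarith [hσ.1]) (by norm_num)
  have hab : (-11 / 25 - σ) / (-11 / 25 - -23 / 50) + (σ - -23 / 50) / (-11 / 25 - -23 / 50) = (1 : ℝ) := by
    rw [← add_div]
    have : (-11 / 25 - σ) + (σ - -23 / 50) = (-11 / 25 - -23 / 50 : ℝ) := by ring
    rw [this]
    exact div_self (by norm_num)
  rw [hcast]
  nlinarith [mul_le_mul_of_nonneg_left hA ha, mul_le_mul_of_nonneg_left hB hb, hab]

end Summit.Ventures.CertifiedManyBodySolver.Theses.CovNdNiO2M21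

end
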